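import Summits.HubbardSuperconductivity.HubbardSuperconductivity.Theorems.LiebTwinRectificationRaisesEnergy
import Summits.HubbardSuperconductivity.HubbardSuperconductivity.Theorems.LiebTwinRealFlipDefiniteSuffices
import Summits.HubbardSuperconductivity.HubbardSuperconductivity.Theorems.LiebTwinNoOnsiteODLROWeakCouplingOnsiteCeiling
import Literature.Barriers.HubbardSuperconductivity.PureModelStripeCompetitionProofs

/-!
# Crux `TwinOnsiteCondensation` (K2, stmt-HubbardSuperconductivity-15656) — the twin's kinetic energy, and
# the WEAK-COUPLING EXCLUSION: a K2 witness `(U, δ, c)` needs `16c/(10⁵·log²(4 + 8/√c)) ≤ U`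

`--supports stmt-HubbardSuperconductivity-15656` (route `LiebTwin`; registered by-product stub
`stub_twinCondensationNeedsCoupling`). K2 asks for a box point `(U, δ) ∈ (0,4]×[1/10,3/10]` and `c > 0` such
that eventually in even `L` the TWIN `φ̃ = liebVec n |liebW n φ|` of EVERY normalised `(N_L, 0)`-sector
ground state `φ` has on-site pair density `F_s(φ̃) ≥ c·L⁴`. This file proves that such a witness cannot sit
at arbitrarily weak coupling, for every ground state and with no reality / flip-definiteness hypothesis:

* `hsInner_liebOp_zero`, `hsInner_cfcAbs_liebOp_zero` (matrix side): the free (`U = 0`) Lieb form of any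
  coefficient matrix `W` is `tr K WWᴴ + tr K WᴴW` (the `↑` and `↓` kinetic energies), and that of its
  rectification `|W| = (WᴴW)^{1/2}` is `2·tr K WᴴW` — **the twin carries twice the `↓`-kinetic energy**;
  in particular rectification PRESERVES the kinetic energy of every vector with normal Lieb matrix
  (`hsInner_cfcAbs_liebOp_zero_of_normal`: real flip-definite states), so the energy rise of
  `RectificationRaisesEnergy` is purely the interaction term `U·(D(φ̃) − D(φ))`.
* `liebW_star_flip`: the conjugated spin-flipped vector `φ' = conj(F φ)` has Lieb matrix `(−1)^{n²}·Wᴴ`, so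
  its twin carries `2·tr K WWᴴ` (`expect_kinetic_twin_add`): the two twins' kinetic energies add up to
  `2⟨φ, T φ⟩`, and `φ'` is again a normalised sector ground state when `φ` is.
* `exists_groundState_twin_kinetic_le`: hence at coupling `U ≥ 0` SOME normalised ground state of the sector
  has a twin whose free kinetic energy is within the first-order budget `U·L²` of the free sector ground energy
  (`re_expect_hubbardTorus_zero_le_of_groundStateInSector`); by the on-site pairing-cost theorem
  (`NoOnsiteODLRO.OnsiteCeiling.freeOnsitePairing_costs_energy_uniform_rate`) its twin has on-site density
  `< c` unless `16c/(10⁵·log²(4 + 8/√c)) ≤ U`.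
* `twinCondensation_needs_coupling` / `stub_twinCondensationNeedsCoupling` (K2's vocabulary): if at
  `(U, δ)`, `U ≥ 0`, `δ ∈ [0,1]`, some `c > 0` and `L₀` make `c·L⁴ ≤ F_s(φ̃)` for every normalised
  `(2⌊(1−δ)L²/2⌋, 0)`-sector ground state `φ` at every even `L ≥ L₀`, then `16c/(10⁵·log²(4 + 8/√c)) ≤ U`;
  `twinCondensation_fails_at_weak_coupling`: the K2 floor fails at every `(U, δ)` with `U` below that threshold.

Numerically the threshold is tiny (`≈ 10⁻⁵·c` for `c ≤ 1/2`), far inside K2's box `U ≤ 4`; the content is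
structural: the twin of a weakly repulsive ground state does not condense on-site either (its condensate
density is `O(U log²(1/U))` like the ground state's own, `OnsiteCeiling`), so the route's bet lives at
`U ≳ U₀(c)`.

Sources: E. H. Lieb, PRL 62 (1989) 1201, proof of Theorem 1 (the matrix form `⟨W, KW + WK⟩`);
J. Bardeen, L. N. Cooper, J. R. Schrieffer, Phys. Rev. 108 (1957) 1175, §II; C. N. Yang, Rev. Mod. Phys. 34
(1962) 694, §3; H. Tasaki (2020) §2.2. Folklore finite-dimensional statements; no named facts, no
definitions. Tree: `expect_hamiltonian_eq_hsInner_liebOp`, `LiebThm1.liebW_liebVec`, `isInSector_liebVec`,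
`CFC.abs_mul_abs`, `liebW_fockRelabel_spinSwap_mulVec`, `LiebTwinFlip.eigen_star/eigen_flip`,
`star_fockRelabel_mulVec_dotProduct`, `star_twin_dotProduct_twin`, `szSector_groundState`.
-/

noncomputable section

set_option linter.dupNamespace false

namespace Summit.HubbardSuperconductivity.HubbardSuperconductivity.Theorems.TwinOnsiteCondensation.WeakCoupling

open Matrix Literature.MathematicalPhysics.QuantumLattice Literature.Probability.LatticeModels
open Summit.HubbardSuperconductivity.HubbardSuperconductivity.Theorems.LiebTwinFlip
open scoped ComplexOrder MatrixOrder Matrix.Norms.L2Operator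

/-! ### Matrix side: the free Lieb form of `W` and of `|W|` -/

section MatrixSide

variable {A X : Type*} [Fintype A] [DecidableEq A] [Fintype X]

omit [DecidableEq A] in
/-- **The free Lieb form** of a coefficient matrix: `⟨W, KW + WK⟩_HS = tr K WWᴴ + tr K WᴴW` (the two
spin species' kinetic energies). Lieb, PRL 62 (1989) 1201, eq. (3) at `U = 0`. [folklore] -/
theorem hsInner_liebOp_zero (K : Matrix A A ℂ) (L : X → Matrix A A ℂ) (W : Matrix A A ℂ) :
    hsInner W (liebOp K L 0 W) = (K * (W * Wᴴ)).trace + (K * (Wᴴ * W)).trace := by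
  rw [liebOp, Complex.ofReal_zero, zero_smul, add_zero, hsInner, Matrix.mul_add, trace_add]
  have h1 : (Wᴴ * (K * W)).trace = (K * (W * Wᴴ)).trace := by
    rw [trace_mul_comm, Matrix.mul_assoc]
  have h2 : (Wᴴ * (W * K)).trace = (K * (Wᴴ * W)).trace := by
    rw [← Matrix.mul_assoc, trace_mul_comm]
  rw [h1, h2]

/-- **The free Lieb form of the rectification**: `⟨|W|, K|W| + |W|K⟩_HS = 2·tr K WᴴW` for every square
`W` (`|W|ᴴ = |W|`, `|W||W| = WᴴW`): the twin carries twice the `↓`-species kinetic energy. Lieb, PRL 62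
(1989) 1201, proof of Theorem 1. [folklore] -/
theorem hsInner_cfcAbs_liebOp_zero (K : Matrix A A ℂ) (L : X → Matrix A A ℂ) (W : Matrix A A ℂ) :
    hsInner (CFC.abs W) (liebOp K L 0 (CFC.abs W)) = 2 * (K * (Wᴴ * W)).trace := by
  have hsa : (CFC.abs W)ᴴ = CFC.abs W := (CFC.abs_nonneg W).isSelfAdjoint.star_eq
  have hsq : CFC.abs W * CFC.abs W = Wᴴ * W := by rw [CFC.abs_mul_abs, star_eq_conjTranspose]
  rw [hsInner_liebOp_zero, hsa, hsq, two_mul]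

/-- **Rectification preserves the free form of a normal matrix**: if `WᴴW = WWᴴ` (e.g. `W` Hermitian or
skew-Hermitian — the real flip-definite vectors of the route), `⟨|W|, K|W| + |W|K⟩_HS = ⟨W, KW + WK⟩_HS`.
So for such vectors the energy rise of `RectificationRaisesEnergy` is the interaction term alone.
Lieb, PRL 62 (1989) 1201, proof of Theorem 1. [folklore] -/
theorem hsInner_cfcAbs_liebOp_zero_of_normal (K : Matrix A A ℂ) (L : X → Matrix A A ℂ) {W : Matrix A A ℂ}
    (hW : Wᴴ * W = W * Wᴴ) :
    hsInner (CFC.abs W) (liebOp K L 0 (CFC.abs W)) = hsInner W (liebOp K L 0 W) := by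
  rw [hsInner_cfcAbs_liebOp_zero, hsInner_liebOp_zero, ← hW, two_mul]

end MatrixSide

/-! ### Fock side: kinetic energy of a sector vector, of its twin, and of the conjugate-flipped twin -/

section FockSide

variable {Λ : Type*} [LinearOrder Λ] [Fintype Λ]

/-- `W(conj χ) = conj W(χ)` entrywise (the pair sign is real). [folklore] -/
theorem liebW_star_apply (n : ℕ) (χ : Fock (Orb Λ)) (α β : Config Λ n) :
    liebW n (star χ) α β = star (liebW n χ α β) := by
  rw [liebW_apply, liebW_apply, star_mul', LiebThm1.star_pairSign]
  rfl

/-- **Lieb matrix of the conjugated spin flip**: `W(conj (F χ)) = (−1)^{n²} · W(χ)ᴴ`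
(`W(F χ) = (−1)^{n²} W(χ)ᵀ`, `liebW_fockRelabel_spinSwap_mulVec`, then entrywise conjugation).
Lieb, PRL 62 (1989) 1201, proof of Theorem 1. [folklore] -/
theorem liebW_star_flip (n : ℕ) (χ : Fock (Orb Λ)) :
    liebW n (star ((fockRelabel (Orb.spinSwap : Orb Λ ≃ Orb Λ)).val *ᵥ χ)) =
      ((-1 : ℂ) ^ (n * n)) • (liebW n χ)ᴴ := by
  ext α β
  rw [liebW_star_apply, liebW_fockRelabel_spinSwap_mulVec, Matrix.smul_apply, Matrix.smul_apply,
    transpose_apply, conjTranspose_apply, smul_eq_mul, smul_eq_mul, star_mul', star_pow, star_neg, star_one]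

/-- `W'ᴴ W' = W Wᴴ` for `W' = W(conj (F χ))`, `W = W(χ)` (`(−1)^{n²}` squares to `1`). [folklore] -/
theorem conjTranspose_mul_self_liebW_star_flip (n : ℕ) (χ : Fock (Orb Λ)) :
    (liebW n (star ((fockRelabel (Orb.spinSwap : Orb Λ ≃ Orb Λ)).val *ᵥ χ)))ᴴ *
        liebW n (star ((fockRelabel (Orb.spinSwap : Orb Λ ≃ Orb Λ)).val *ᵥ χ)) =
      liebW n χ * (liebW n χ)ᴴ := by
  rw [liebW_star_flip, conjTranspose_smul, conjTranspose_conjTranspose, Matrix.smul_mul, Matrix.mul_smul,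
    smul_smul]
  have hs : star ((-1 : ℂ) ^ (n * n)) * (-1 : ℂ) ^ (n * n) = 1 := by
    rw [star_pow, star_neg, star_one, ← mul_pow, neg_mul_neg, one_mul, one_pow]
  rw [hs, one_smul]

variable [DecidableEq Λ] (G : SimpleGraph Λ) [DecidableRel G.Adj]

omit [DecidableEq Λ] in
/-- **Kinetic energy in Lieb coordinates**: for `ψ` in the `(n, n)` sector,
`⟨ψ, H(t,0) ψ⟩ = tr K WWᴴ + tr K WᴴW`, `W = liebW n ψ`, `K = liebK G t n`. Lieb, PRL 62 (1989) 1201,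
eq. (3). [folklore] -/
theorem expect_kinetic_eq (t : ℝ) {n : ℕ} {ψ : Fock (Orb Λ)} (hψ : IsInSector n n ψ) :
    expect (hamiltonian G t 0) ψ =
      (liebK G t n * (liebW n ψ * (liebW n ψ)ᴴ)).trace + (liebK G t n * ((liebW n ψ)ᴴ * liebW n ψ)).trace := by
  rw [expect_hamiltonian_eq_hsInner_liebOp G t 0 hψ, hsInner_liebOp_zero]

/-- **Kinetic energy of a twin**: `⟨liebVec n |W|, H(t,0) liebVec n |W|⟩ = 2·tr K WᴴW` for every
coefficient matrix `W`. Lieb, PRL 62 (1989) 1201, proof of Theorem 1. [folklore] -/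
theorem expect_kinetic_twin (t : ℝ) (n : ℕ) (W : Matrix (Config Λ n) (Config Λ n) ℂ) :
    expect (hamiltonian G t 0) (liebVec n (CFC.abs W)) = 2 * (liebK G t n * (Wᴴ * W)).trace := by
  rw [expect_hamiltonian_eq_hsInner_liebOp G t 0 (isInSector_liebVec n _), LiebThm1.liebW_liebVec,
    hsInner_cfcAbs_liebOp_zero]

/-- **The two twins share out twice the kinetic energy**: for `ψ` in the `(n, n)` sector, the twin of `ψ`
and the twin of `conj (F ψ)` have free kinetic energies adding up to `2⟨ψ, H(t,0) ψ⟩`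
(`2 tr K WᴴW + 2 tr K WWᴴ`). Lieb, PRL 62 (1989) 1201. [folklore] -/
theorem expect_kinetic_twin_add (t : ℝ) {n : ℕ} {ψ : Fock (Orb Λ)} (hψ : IsInSector n n ψ) :
    expect (hamiltonian G t 0) (liebVec n (CFC.abs (liebW n ψ))) +
        expect (hamiltonian G t 0)
          (liebVec n (CFC.abs (liebW n (star ((fockRelabel (Orb.spinSwap : Orb Λ ≃ Orb Λ)).val *ᵥ ψ))))) =
      2 * expect (hamiltonian G t 0) ψ := by
  rw [expect_kinetic_twin, expect_kinetic_twin, conjTranspose_mul_self_liebW_star_flip,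
    expect_kinetic_eq G t hψ]
  ring

/-- **Rectification preserves the kinetic energy of real flip-definite vectors**: for a real `(n,n)`-sector
`φ` with `W(φ)ᵀ = ± W(φ)`, `⟨φ̃, H(t,0) φ̃⟩ = ⟨φ, H(t,0) φ⟩` (`W` is then normal). Lieb, PRL 62 (1989) 1201,
proof of Theorem 1. [folklore] -/
theorem expect_kinetic_twin_eq_of_real_flip (t : ℝ) {n : ℕ} {φ : Fock (Orb Λ)}
    (hreal : ∀ s, star (φ s) = φ s) (hφ : IsInSector n n φ)
    (hflip : (liebW n φ)ᵀ = liebW n φ ∨ (liebW n φ)ᵀ = -liebW n φ) :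
    expect (hamiltonian G t 0) (liebVec n (CFC.abs (liebW n φ))) = expect (hamiltonian G t 0) φ := by
  have hct : (liebW n φ)ᴴ = (liebW n φ)ᵀ := by
    ext α β
    rw [conjTranspose_apply, transpose_apply, ← liebW_star_apply]
    congr 1
    exact funext hreal
  have hnormal : (liebW n φ)ᴴ * liebW n φ = liebW n φ * (liebW n φ)ᴴ := by
    rw [hct]
    rcases hflip with h | h
    · rw [h]
    · rw [h, Matrix.neg_mul, Matrix.mul_neg]
  rw [expect_hamiltonian_eq_hsInner_liebOp G t 0 (isInSector_liebVec n _), LiebThm1.liebW_liebVec,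
    expect_hamiltonian_eq_hsInner_liebOp G t 0 hφ, hsInner_cfcAbs_liebOp_zero_of_normal _ _ hnormal]

end FockSide

/-! ### The repulsive torus: some ground state has a kinetically cheap twin -/

section Torus

variable {L : ℕ} [NeZero L]

omit [NeZero L] in
/-- **The conjugate-flipped ground state.** If `φ` is a normalised `(2n, 0)`-sector ground state of
`hubbardTorus 2 L 1 U`, so is `conj (F φ)` (`H` is real and spin-flip invariant; `F` is unitary).
Lieb, PRL 62 (1989) 1201, proof of Theorem 1. [folklore] -/
theorem star_flip_groundState {U : ℝ} {n : ℕ} {φ : Fock (Orb (FermionTorus 2 L))}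
    (hφ : IsGroundStateInSector (hubbardTorus 2 L 1 U) (2 * n) 0 φ) (h1 : star φ ⬝ᵥ φ = 1) :
    star (star ((fockRelabel (Orb.spinSwap : Orb (FermionTorus 2 L) ≃ Orb (FermionTorus 2 L))).val *ᵥ φ)) ⬝ᵥ
          star ((fockRelabel (Orb.spinSwap : Orb (FermionTorus 2 L) ≃ Orb (FermionTorus 2 L))).val *ᵥ φ) = 1 ∧
      IsGroundStateInSector (hubbardTorus 2 L 1 U) (2 * n) 0
        (star ((fockRelabel (Orb.spinSwap : Orb (FermionTorus 2 L) ≃ Orb (FermionTorus 2 L))).val *ᵥ φ)) := by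
  obtain ⟨hmem, -, heig⟩ := hφ
  have hnorm : star (star ((fockRelabel (Orb.spinSwap : Orb (FermionTorus 2 L) ≃ Orb (FermionTorus 2 L))).val *ᵥ φ)) ⬝ᵥ
      star ((fockRelabel (Orb.spinSwap : Orb (FermionTorus 2 L) ≃ Orb (FermionTorus 2 L))).val *ᵥ φ) = 1 := by
    rw [star_star, dotProduct_comm, star_fockRelabel_mulVec_dotProduct, h1]
  have hflip := eigen_flip hmem heig
  have hstar := eigen_star hflip.1 hflip.2
  refine ⟨hnorm, hstar.1, ?_, hstar.2⟩
  intro h0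
  rw [h0, star_zero, zero_dotProduct] at hnorm
  exact zero_ne_one hnorm

omit [NeZero L] in
/-- **Some ground state has a kinetically cheap twin.** For `U ≥ 0`, `n ≤ L²` and a normalised
`(2n, 0)`-sector ground state `φ` of `hubbardTorus 2 L 1 U`: one of `φ`, `conj (F φ)` is a normalised sector
ground state `χ` whose twin `χ̃ = liebVec n |liebW n χ|` has free kinetic energy
`Re⟨χ̃, H(1,0) χ̃⟩ ≤ minEnergyOn H(1,0) (szSector (2n) 0) + U·L²` (the two twins' kinetic energies add up to
`2⟨φ, H(1,0) φ⟩ ≤ 2·(free ground energy + U·L²)`). Lieb (1989); Tasaki (2020) §2.2. [folklore] -/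
theorem exists_groundState_twin_kinetic_le {U : ℝ} (hU : 0 ≤ U) {n : ℕ} (hn : n ≤ L ^ 2)
    {φ : Fock (Orb (FermionTorus 2 L))}
    (hφ : IsGroundStateInSector (hubbardTorus 2 L 1 U) (2 * n) 0 φ) (h1 : star φ ⬝ᵥ φ = 1) :
    ∃ χ : Fock (Orb (FermionTorus 2 L)), star χ ⬝ᵥ χ = 1 ∧
      IsGroundStateInSector (hubbardTorus 2 L 1 U) (2 * n) 0 χ ∧
        (star (liebVec n (CFC.abs (liebW n χ))) ⬝ᵥ
            (hubbardTorus 2 L 1 0 *ᵥ liebVec n (CFC.abs (liebW n χ)))).re ≤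
          (hubbardTorus 2 L 1 0).minEnergyOn (szSector (Λ := FermionTorus 2 L) (2 * n) 0) +
            U * (L : ℝ) ^ 2 := by
  have hbudget := re_expect_hubbardTorus_zero_le_of_groundStateInSector hU hn hφ h1
  have hsec : IsInSector n n φ := (mem_szSector_two_mul_zero_iff n φ).1 hφ.1
  have hsum := expect_kinetic_twin_add (fermionTorusGraph 2 L) 1 hsec
  -- real parts: `a + b = 2 k`
  have hre := congrArg Complex.re hsum
  simp only [Complex.add_re, Complex.mul_re, Complex.re_ofNat, Complex.im_ofNat, zero_mul, sub_zero] at hre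
  have hk : (expect (hamiltonian (fermionTorusGraph 2 L) 1 0) φ).re ≤
      (hubbardTorus 2 L 1 0).minEnergyOn (szSector (Λ := FermionTorus 2 L) (2 * n) 0) + U * (L : ℝ) ^ 2 :=
    hbudget
  rcases le_or_gt ((expect (hamiltonian (fermionTorusGraph 2 L) 1 0) (liebVec n (CFC.abs (liebW n φ)))).re)
      ((expect (hamiltonian (fermionTorusGraph 2 L) 1 0) φ).re) with hle | hgt
  · exact ⟨φ, h1, hφ, hle.trans hk⟩
  · obtain ⟨h1', hgs'⟩ := star_flip_groundState hφ h1
    refine ⟨_, h1', hgs', ?_⟩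
    have hb : (expect (hamiltonian (fermionTorusGraph 2 L) 1 0) (liebVec n (CFC.abs (liebW n
        (star ((fockRelabel (Orb.spinSwap : Orb (FermionTorus 2 L) ≃ Orb (FermionTorus 2 L))).val *ᵥ φ)))))).re ≤
        (expect (hamiltonian (fermionTorusGraph 2 L) 1 0) φ).re := by
      linarith
    exact hb.trans hk

/-- **A twin on-site condensate needs coupling (pointwise).** For `U ≥ 0`, `c > 0`, `n ≤ L²`,
`L ≥ ⌈800/√c⌉ + 3`: if the twin of EVERY normalised `(2n, 0)`-sector ground state of `hubbardTorus 2 L 1 U`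
has `c·L⁴ ≤ F_s(φ̃)`, then `16c/(10⁵·log²(4 + 8/√c)) ≤ U` (apply the on-site pairing cost
`NoOnsiteODLRO.OnsiteCeiling.freeOnsitePairing_costs_energy_uniform_rate` to the kinetically cheap twin of
`exists_groundState_twin_kinetic_le`; a ground state exists by `szSector_groundState`).
Bardeen–Cooper–Schrieffer (1957) §II; Lieb (1989). [folklore] -/
theorem twinCondensation_needs_coupling_at {U c : ℝ} (hU : 0 ≤ U) (hc : 0 < c) {n : ℕ} (hn : n ≤ L ^ 2)
    (hL : ⌈800 / Real.sqrt c⌉₊ + 3 ≤ L)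
    (hyp : ∀ φ : Fock (Orb (FermionTorus 2 L)), star φ ⬝ᵥ φ = 1 →
      IsGroundStateInSector (hubbardTorus 2 L 1 U) (2 * n) 0 φ →
        c * (L : ℝ) ^ 4 ≤
          (expect ((pairField sWave L)ᴴ * pairField sWave L) (liebVec n (CFC.abs (liebW n φ)))).re) :
    16 * c / (100000 * Real.log (4 + 8 / Real.sqrt c) ^ 2) ≤ U := by
  -- a normalised ground state
  have hn' : n ≤ Fintype.card (FermionTorus 2 L) := by simpa using hn
  obtain ⟨⟨φ₀, hφ₀S, hφ₀0, hHφ₀⟩, -⟩ := szSector_groundState (fermionTorusGraph 2 L) 1 U hn'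
  obtain ⟨r, hr0, hr1⟩ := Literature.MathematicalPhysics.QuantumLattice.exists_smul_unit hφ₀0
  have hgs : IsGroundStateInSector (hubbardTorus 2 L 1 U) (2 * n) 0 (r • φ₀) :=
    ⟨Submodule.smul_mem _ _ hφ₀S, smul_ne_zero hr0 hφ₀0, by
      rw [mulVec_smul]
      change r • (hamiltonian (fermionTorusGraph 2 L) 1 U *ᵥ φ₀) = _
      rw [hHφ₀, smul_comm]
      rfl⟩
  -- the ground state with the cheap twin
  obtain ⟨χ, hχ1, hχgs, hkin⟩ := exists_groundState_twin_kinetic_le hU hn hgs hr1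
  have hsecχ : IsInSector n n χ := (mem_szSector_two_mul_zero_iff n χ).1 hχgs.1
  set τ := liebVec n (CFC.abs (liebW n χ)) with hτ
  have hτ1 : star τ ⬝ᵥ τ = 1 := by rw [hτ, star_twin_dotProduct_twin hsecχ, hχ1]
  have hτmem : τ ∈ szSector (Λ := FermionTorus 2 L) (2 * n) 0 :=
    (mem_szSector_two_mul_zero_iff n τ).2 (isInSector_liebVec n _)
  have hY := hyp χ hχ1 hχgs
  have hcost := NoOnsiteODLRO.OnsiteCeiling.freeOnsitePairing_costs_energy_uniform_rate hc hL hτmem hτ1 hY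
  have hL2 : (0 : ℝ) < (L : ℝ) ^ 2 := by
    have : (0 : ℝ) < (L : ℝ) := by exact_mod_cast Nat.pos_of_ne_zero (NeZero.ne L)
    positivity
  have hmul : 16 * c / (100000 * Real.log (4 + 8 / Real.sqrt c) ^ 2) * (L : ℝ) ^ 2 ≤ U * (L : ℝ) ^ 2 := by
    linarith
  exact le_of_mul_le_mul_right hmul hL2

/-- **K2's vocabulary: a twin on-site condensate needs coupling.** For `U ≥ 0`, `δ ≥ -1`, `c > 0`: if
there is `L₀` such that at every even `L ≥ L₀` the twin of EVERY normalised `(2⌊(1-δ)L²/2⌋, 0)`-sector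
ground state of `hubbardTorus 2 L 1 U` has `c·L⁴ ≤ F_s(φ̃)` (the floor asserted by `TwinOnsiteCondensation`
at its witness), then `16c/(10⁵·log²(4 + 8/√c)) ≤ U`. Bardeen–Cooper–Schrieffer (1957) §II; Lieb (1989).
[folklore] -/
theorem twinCondensation_needs_coupling {U δ c : ℝ} (hU : 0 ≤ U) (hδ : -1 ≤ δ) (hc : 0 < c)
    (hyp : ∃ L₀ : ℕ, ∀ (L : ℕ) [NeZero L], L₀ ≤ L → Even L →
      ∀ φ : Fock (Orb (FermionTorus 2 L)), star φ ⬝ᵥ φ = 1 →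
        IsGroundStateInSector (hubbardTorus 2 L 1 U) (2 * ⌊(1 - δ) * (L : ℝ) ^ 2 / 2⌋₊) 0 φ →
          c * (L : ℝ) ^ 4 ≤
            (expect ((pairField sWave L)ᴴ * pairField sWave L)
              (liebVec ⌊(1 - δ) * (L : ℝ) ^ 2 / 2⌋₊
                (CFC.abs (liebW ⌊(1 - δ) * (L : ℝ) ^ 2 / 2⌋₊ φ)))).re) :
    16 * c / (100000 * Real.log (4 + 8 / Real.sqrt c) ^ 2) ≤ U := by
  obtain ⟨L₀, hL₀⟩ := hyp
  -- an even side beyond both thresholds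
  set L : ℕ := 2 * (L₀ + ⌈800 / Real.sqrt c⌉₊ + 3) with hLdef
  haveI : NeZero L := ⟨by omega⟩
  have hLe : Even L := ⟨L₀ + ⌈800 / Real.sqrt c⌉₊ + 3, by omega⟩
  have hL0 : L₀ ≤ L := by omega
  have hLc : ⌈800 / Real.sqrt c⌉₊ + 3 ≤ L := by omega
  exact twinCondensation_needs_coupling_at hU hc (Literature.Barriers.HubbardSuperconductivity.natFloor_filling_le_sq hδ L) hLc
    (fun φ h1 hgs => hL₀ L hL0 hLe φ h1 hgs)

/-- **The K2 floor fails at weak coupling.** For `c > 0`, `0 ≤ U < 16c/(10⁵·log²(4 + 8/√c))` and `δ ≥ -1`: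
at `(U, δ)` there is NO `L₀` beyond which the twin of every normalised sector ground state has on-site pair
density `≥ c` — any witness `(U, δ, c)` of `TwinOnsiteCondensation` has `U ≥ 16c/(10⁵·log²(4 + 8/√c))`.
[folklore] -/
theorem twinCondensation_fails_at_weak_coupling {U δ c : ℝ} (hc : 0 < c) (hU0 : 0 ≤ U)
    (hU : U < 16 * c / (100000 * Real.log (4 + 8 / Real.sqrt c) ^ 2)) (hδ : -1 ≤ δ) :
    ¬ ∃ L₀ : ℕ, ∀ (L : ℕ) [NeZero L], L₀ ≤ L → Even L →
      ∀ φ : Fock (Orb (FermionTorus 2 L)), star φ ⬝ᵥ φ = 1 →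
        IsGroundStateInSector (hubbardTorus 2 L 1 U) (2 * ⌊(1 - δ) * (L : ℝ) ^ 2 / 2⌋₊) 0 φ →
          c * (L : ℝ) ^ 4 ≤
            (expect ((pairField sWave L)ᴴ * pairField sWave L)
              (liebVec ⌊(1 - δ) * (L : ℝ) ^ 2 / 2⌋₊
                (CFC.abs (liebW ⌊(1 - δ) * (L : ℝ) ^ 2 / 2⌋₊ φ)))).re :=
  fun h => absurd (twinCondensation_needs_coupling hU0 hδ hc h) (not_le.2 hU)

/-- REGISTERED STUB `stub_twinCondensationNeedsCoupling` of crux stmt-HubbardSuperconductivity-15656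
(`TwinOnsiteCondensation`, K2; verbatim signature; a BY-PRODUCT — the weak-coupling exclusion — not a piece of a
line composition): in K2's box, any `(U, δ, c, L₀)` realising the K2 floor has
`16c/(10⁵·log²(4 + 8/√c)) ≤ U` (`= twinCondensation_needs_coupling`). [folklore] -/
theorem stub_twinCondensationNeedsCoupling :
    open Literature.MathematicalPhysics.QuantumLattice in
    ∀ U ∈ Set.Ioc (0 : ℝ) 4, ∀ δ ∈ Set.Icc (1 / 10 : ℝ) (3 / 10), ∀ c : ℝ, 0 < c →
      (∃ L₀ : ℕ, ∀ (L : ℕ) [NeZero L], L₀ ≤ L → Even L →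
        ∀ φ : Fock (Orb (FermionTorus 2 L)), star φ ⬝ᵥ φ = 1 →
          IsGroundStateInSector (hubbardTorus 2 L 1 U) (2 * ⌊(1 - δ) * (L : ℝ) ^ 2 / 2⌋₊) 0 φ →
            c * (L : ℝ) ^ 4 ≤
              (expect ((pairField sWave L)ᴴ * pairField sWave L)
                (liebVec ⌊(1 - δ) * (L : ℝ) ^ 2 / 2⌋₊
                  (CFC.abs (liebW ⌊(1 - δ) * (L : ℝ) ^ 2 / 2⌋₊ φ)))).re) →
        16 * c / (100000 * Real.log (4 + 8 / Real.sqrt c) ^ 2) ≤ U :=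
  fun _ hU _ hδ _ hc hyp =>
    twinCondensation_needs_coupling hU.1.le (by linarith [hδ.1]) hc hyp

end Torus

end Summit.HubbardSuperconductivity.HubbardSuperconductivity.Theorems.TwinOnsiteCondensation.WeakCoupling
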